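import Summits.ABC.ABC.Statement
import Summits.ABC.ABC.Theses.TwistAmplification
import Summits.ABC.ABC.Theorems.SomeWindowSaving.Negative.WindowFinite
import Summits.ABC.ABC.Theorems.TwistAmplificationAssembly
import Summits.ABC.ABC.Theorems.TwistAmplificationTwistAmplificationLemma
import Literature.NumberTheory.EllipticCurves.SzpiroBGEquivalenceProofs
import HarnessLib

/-!
# Route TwistAmplification — crux `ModerateWindowCount` (stmt-ABC-1973): the inert box and the calibration

Kernel-checked calibration of the crux `Summit.ABC.ABC.Theses.TwistAmplification.ModerateWindowCount`
(line lead, 2026-08-16; the Theorems-side form of §3 of the standing disprover's workfile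
`Cruxes/ModerateWindowCount/Disproof.lean` and of §1 of the line sketch
`Cruxes/ModerateWindowCount/SketchIdeator3.lean`, neither of which is importable here).

The crux asks: for every `σ > 6` there are `κ ∈ (3, σ)`, `δ < (σ − κ)/(2σ − 6)` and `C` with
`T⁺_[κ,σ](X) ≤ C · X^δ` for all `X ≥ 1`, where `T⁺_[κ,σ](X)` counts reduced global minimal models
`W₀/ℤ` with `c₄ c₆ ≠ 0`, conductor `N ≤ X` and `N^κ ≤ M⁺ := max(|Δ|, |c₄|³) ≤ N^σ` — literally
`Negative.windowCount κ σ X` of `Theorems/SomeWindowSaving/Negative/Defs.lean` (same set-builder,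
`moderateWindowCount_iff` below is `Iff.rfl`).

* `moderateWindowCount_of_cofiniteGenSzpiroAll` — **the inert box at `κ ∈ (6, σ)`.** COFINITE
  GENERALIZED SZPIRO FOR EVERY EXPONENT `s > 6` (for each `s > 6` some `N₀` beyond which every minimal
  integral model with `c₄ c₆ ≠ 0` has `M⁺ ≤ N^s`) implies the crux with NO counting: given `σ > 6`
  take `κ := (σ + 6)/2`, `s := (κ + 6)/2 ∈ (6, κ)`, `δ := 0`; a window member of conductor
  `n ≥ max N₀ 2` would have `n^κ ≤ M⁺ ≤ n^s < n^κ`, so every slice sits inside the finite slice at scale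
  `max N₀ 2` (`Negative.windowSet_finite`) and its cardinality is the constant.
* `cofiniteGenSzpiroAll_of_generalizedSzpiroBG`, `moderateWindowCount_of_generalizedSzpiroBG`,
  `moderateWindowCount_of_abc` — hence the crux follows from Bombieri–Gubler's generalized Szpiro
  conjecture 12.5.11 (`Literature.NumberTheory.EllipticCurves.GeneralizedSzpiroConjectureBG`) and from
  the summit `ABC` itself (B–G Thm. 12.5.12 (a) ⟹ (c), `abcLe_iff_generalizedSzpiroBG_holds`, PROVED
  in the tree). CONDITIONAL results: they record that the crux cannot fail unless abc fails.
* `cofiniteGenSzpiroAll_of_moderateWindowCount`, `abc_of_moderateWindowCount` — the converse, modulo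
  the route's one open support `QuadraticTwistInvariants` (stmt-ABC-1977; Tate's algorithm for prime-to-`6N`
  quadratic twists): the crux gives cofinite generalized Szpiro for every exponent `> 6` (the closed
  support `twistAmplificationLemma_proof`, stmt-ABC-1978, through
  `TwistAmplificationAssembly.cofinite_genSzpiro`) and hence abc (Frey bookkeeping + Mahler,
  `twistAmplification_assembly_proof`).
* `cofiniteGenSzpiroAll_iff_abc` (UNCONDITIONAL) and `moderateWindowCount_iff_abc`
  (modulo stmt-ABC-1977) — the calibration in one line each: the only honest stub of any line of
  this crux, cofinite generalized Szpiro for all exponents `> 6`, IS the summit; and the crux as typed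
  is the summit modulo one Tate-algorithm support. (So the crux is not a place where work weaker than
  abc can be done; inside the route it is DERIVED from the crux `SharpModerateLaw`, stmt-ABC-1975, by
  the closed glue `sharpLawGivesWindow_proof`, stmt-ABC-14144.)
* `someWindowSaving_of_moderateWindowCount` — the rung order: the crux implies the sibling crux
  `SomeWindowSaving` (stmt-ABC-1976), instance `σ := 7`.
* `moderateWindowCount_of_nearViolatorSparsity` — the `κ := 6` lever of the idea cards
  kappa-six-near-violators / exceptional-set-by-conductor (glue only; its hypothesis is STRONGER than
  the crux: it adds at-the-line statistics not implied by abc).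

Deliberately NOT here: any claim about `QuadraticTwistInvariants` (worked by the sibling crux's lead)
or about the at-the-line statistics. Lands `--supports stmt-ABC-1973`.
-/

noncomputable section

open IsDedekindDomain WeierstrassCurve
open Summit.ABC.ABC.Theses.TwistAmplification (ModerateWindowCount SomeWindowSaving
  QuadraticTwistInvariants TwistAmplificationLemma)
open Summit.ABC.ABC.Theorems.SomeWindowSaving.Negative (windowSet windowCount windowSet_finite
  someWindowSaving_iff)
open Literature.NumberTheory.EllipticCurves (GeneralizedSzpiroConjectureBG
  abcLe_iff_generalizedSzpiroBG_holds)

-- `Summit.<Summit>.<Problem>` is the mandated summit-side namespace (CONVENTIONS §2); for the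
-- single-conjunct summit `ABC` the two coincide, so the duplicate `ABC.ABC` is deliberate.
set_option linter.dupNamespace false

namespace Summit.ABC.ABC.Theorems

/-- The crux restated through `Negative.windowCount` (definitional: same set-builder). [folklore] -/
theorem moderateWindowCount_iff :
    ModerateWindowCount ↔ ∀ σ : ℝ, 6 < σ → ∃ κ δ C : ℝ, 3 < κ ∧ κ < σ ∧ δ < (σ - κ) / (2 * σ - 6) ∧
      ∀ X : ℝ, 1 ≤ X → (windowCount κ σ X : ℝ) ≤ C * X ^ δ :=
  Iff.rfl

/-- **Window confinement.** Under a cofinite bound `M⁺ ≤ N^s` beyond conductor `N₀` (minimal integral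
models with `c₄ c₆ ≠ 0`), a window slice whose LOWER exponent `κ` exceeds `s` contains only curves of
conductor `< max N₀ 2`, hence lies in the slice at scale `max N₀ 2`: a member of conductor
`n ≥ max N₀ 2` would have `n^κ ≤ M⁺ ≤ n^s < n^κ`. [folklore] -/
theorem ModerateWindowCount.windowSet_subset_of_cofinite {s κ σ N₀ : ℝ} (hsκ : s < κ)
    (h : ∀ W₀ : WeierstrassCurve ℤ, (W₀.baseChange ℚ).IsElliptic →
      (∀ v : HeightOneSpectrum ℤ, (W₀.baseChange ℚ).IsMinimalAt v) → W₀.c₄ ≠ 0 → W₀.c₆ ≠ 0 →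
        N₀ ≤ (((W₀.baseChange ℚ).conductorNorm ℤ : ℕ) : ℝ) →
          ((max |W₀.Δ| (|W₀.c₄| ^ 3) : ℤ) : ℝ) ≤ (((W₀.baseChange ℚ).conductorNorm ℤ : ℕ) : ℝ) ^ s)
    (X : ℝ) : windowSet κ σ X ⊆ windowSet κ σ (max N₀ 2) := by
  intro W hW
  obtain ⟨hE, hmin, ha₁, ha₃, ha₂, hc₄, hc₆, -, hlo, hhi⟩ := hW
  refine ⟨hE, hmin, ha₁, ha₃, ha₂, hc₄, hc₆, ?_, hlo, hhi⟩
  set n : ℝ := (((W.baseChange ℚ).conductorNorm ℤ : ℕ) : ℝ) with hn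
  by_contra hlt
  rw [not_le] at hlt
  have hN₀ : N₀ ≤ n := le_trans (le_max_left _ _) hlt.le
  have hn2 : (2 : ℝ) ≤ n := le_trans (le_max_right _ _) hlt.le
  have hn1 : (1 : ℝ) < n := by linarith
  have hM := h W hE hmin hc₄ hc₆ hN₀
  have h1 : n ^ κ ≤ n ^ s := le_trans hlo hM
  have h2 : n ^ s < n ^ κ := Real.rpow_lt_rpow_of_exponent_lt hn1 hsκ
  linarith

/-- **The `σ`-instance of the crux from ONE cofinite exponent `s < σ`.** If `σ > 6` and
`M⁺ ≤ N^s` holds for all minimal integral models with `c₄ c₆ ≠ 0` and conductor `N ≥ N₀`, for some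
`s < σ`, then the window `(κ, σ]` with `κ := max s 3 / 2 + σ / 2 ∈ (max s 3, σ)` is counted by the
constant `#windowSet κ σ (max N₀ 2)` with saving `δ := 0 < (σ − κ)/(2σ − 6)`. No counting, no twist
facts, no Shafarevich finiteness. [folklore] -/
theorem ModerateWindowCount.instance_of_cofinite {σ s N₀ : ℝ} (hσ : 6 < σ) (hs : s < σ)
    (h : ∀ W₀ : WeierstrassCurve ℤ, (W₀.baseChange ℚ).IsElliptic →
      (∀ v : HeightOneSpectrum ℤ, (W₀.baseChange ℚ).IsMinimalAt v) → W₀.c₄ ≠ 0 → W₀.c₆ ≠ 0 →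
        N₀ ≤ (((W₀.baseChange ℚ).conductorNorm ℤ : ℕ) : ℝ) →
          ((max |W₀.Δ| (|W₀.c₄| ^ 3) : ℤ) : ℝ) ≤ (((W₀.baseChange ℚ).conductorNorm ℤ : ℕ) : ℝ) ^ s) :
    ∃ κ δ C : ℝ, 3 < κ ∧ κ < σ ∧ δ < (σ - κ) / (2 * σ - 6) ∧
      ∀ X : ℝ, 1 ≤ X → (windowCount κ σ X : ℝ) ≤ C * X ^ δ := by
  set t : ℝ := max s 3 with ht
  have hts : s ≤ t := le_max_left _ _
  have ht3 : (3 : ℝ) ≤ t := le_max_right _ _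
  have htσ : t < σ := max_lt hs (by linarith)
  set κ : ℝ := t / 2 + σ / 2 with hκ
  have hsκ : s < κ := by rw [hκ]; linarith
  refine ⟨κ, 0, ((windowSet κ σ (max N₀ 2)).ncard : ℝ), by rw [hκ]; linarith, by rw [hκ]; linarith,
    div_pos (by rw [hκ]; linarith) (by linarith), fun X _ ↦ ?_⟩
  rw [Real.rpow_zero, mul_one]
  exact_mod_cast Set.ncard_le_ncard (ModerateWindowCount.windowSet_subset_of_cofinite hsκ h X)
    (windowSet_finite _ _ _)

/-- **The inert box at `κ ∈ (6, σ)`: cofinite generalized Szpiro for every exponent `s > 6` implies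
the crux.** Hypothesis (abc-strength, OPEN; Bombieri–Gubler Conj. 12.5.11 in cofinite form, on the
non-CM-`j` minimal models the crux counts): for every `s > 6` some `N₀` with
`max(|Δ|, |c₄|³) ≤ N^s` for every integral model minimal at all places, elliptic over `ℚ`, with
`c₄ c₆ ≠ 0` and conductor `N ≥ N₀`. Proof: `ModerateWindowCount.instance_of_cofinite` at
`s := (σ + 6)/2 < σ`. By `cofiniteGenSzpiroAll_of_moderateWindowCount` the hypothesis is also
NECESSARY modulo the support stmt-ABC-1977. [folklore] -/
theorem moderateWindowCount_of_cofiniteGenSzpiroAll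
    (h : ∀ s : ℝ, 6 < s → ∃ N₀ : ℝ, ∀ W₀ : WeierstrassCurve ℤ, (W₀.baseChange ℚ).IsElliptic →
      (∀ v : HeightOneSpectrum ℤ, (W₀.baseChange ℚ).IsMinimalAt v) → W₀.c₄ ≠ 0 → W₀.c₆ ≠ 0 →
        N₀ ≤ (((W₀.baseChange ℚ).conductorNorm ℤ : ℕ) : ℝ) →
          ((max |W₀.Δ| (|W₀.c₄| ^ 3) : ℤ) : ℝ) ≤ (((W₀.baseChange ℚ).conductorNorm ℤ : ℕ) : ℝ) ^ s) :
    ModerateWindowCount := by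
  rw [moderateWindowCount_iff]
  intro σ hσ
  obtain ⟨N₀, hN₀⟩ := h ((σ + 6) / 2) (by linarith)
  exact ModerateWindowCount.instance_of_cofinite hσ (by linarith) hN₀

/-- **Generalized Szpiro (B–G Conj. 12.5.11) ⟹ cofinite generalized Szpiro for every exponent
`s > 6`** on all minimal integral models (a fortiori on those with `c₄ c₆ ≠ 0`): from
`M⁺ ≤ C · N^{6+ε}` with `ε := (s − 6)/2` one gets `M⁺ ≤ N^s` as soon as `N^{(s−6)/2} ≥ C`, i.e. for
`N ≥ N₀ := (max C 1)^{2/(s−6)}`. [folklore] -/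
theorem cofiniteGenSzpiroAll_of_generalizedSzpiroBG (h : GeneralizedSzpiroConjectureBG) :
    ∀ s : ℝ, 6 < s → ∃ N₀ : ℝ, ∀ W₀ : WeierstrassCurve ℤ, (W₀.baseChange ℚ).IsElliptic →
      (∀ v : HeightOneSpectrum ℤ, (W₀.baseChange ℚ).IsMinimalAt v) → W₀.c₄ ≠ 0 → W₀.c₆ ≠ 0 →
        N₀ ≤ (((W₀.baseChange ℚ).conductorNorm ℤ : ℕ) : ℝ) →
          ((max |W₀.Δ| (|W₀.c₄| ^ 3) : ℤ) : ℝ) ≤ (((W₀.baseChange ℚ).conductorNorm ℤ : ℕ) : ℝ) ^ s := by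
  intro s hs
  set γ : ℝ := (s - 6) / 2 with hγ
  have hγ0 : 0 < γ := by rw [hγ]; linarith
  obtain ⟨C, hC⟩ := h γ hγ0
  set B : ℝ := max C 1 with hB
  have hB1 : 1 ≤ B := le_max_right _ _
  have hB0 : 0 < B := by linarith
  refine ⟨B ^ (1 / γ), fun W₀ hE hmin _ _ hN ↦ ?_⟩
  set n : ℝ := (((W₀.baseChange ℚ).conductorNorm ℤ : ℕ) : ℝ) with hn
  have hNB : (1 : ℝ) ≤ B ^ (1 / γ) := Real.one_le_rpow hB1 (by positivity)
  have hn1 : (1 : ℝ) ≤ n := le_trans hNB hN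
  have hn0 : (0 : ℝ) < n := by linarith
  -- `B ≤ n ^ γ`
  have hBn : B ≤ n ^ γ := by
    have h1 : (B ^ (1 / γ)) ^ γ ≤ n ^ γ := Real.rpow_le_rpow (by positivity) hN hγ0.le
    rwa [← Real.rpow_mul hB0.le, one_div, inv_mul_cancel₀ hγ0.ne', Real.rpow_one] at h1
  have hSz : ((max |W₀.Δ| (|W₀.c₄| ^ 3) : ℤ) : ℝ) ≤ C * n ^ (6 + γ) := by exact_mod_cast hC W₀ hE hmin
  calc ((max |W₀.Δ| (|W₀.c₄| ^ 3) : ℤ) : ℝ) ≤ C * n ^ (6 + γ) := hSz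
    _ ≤ B * n ^ (6 + γ) := mul_le_mul_of_nonneg_right (le_max_left _ _) (Real.rpow_nonneg hn0.le _)
    _ ≤ n ^ γ * n ^ (6 + γ) := mul_le_mul_of_nonneg_right hBn (Real.rpow_nonneg hn0.le _)
    _ = n ^ s := by rw [← Real.rpow_add hn0]; congr 1; rw [hγ]; ring

/-- **Generalized Szpiro (B–G Conj. 12.5.11) ⟹ the crux.** The catalogued conjecture
`Literature.NumberTheory.EllipticCurves.GeneralizedSzpiroConjectureBG` (`∀ ε > 0 ∃ C, M⁺ ≤ C · N^{6+ε}`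
for all minimal integral models; verbatim the retired item stmt-ABC-10576) gives `ModerateWindowCount`
through the inert box. CONDITIONAL on that open conjecture (≡ abc, B–G Thm. 12.5.12). [folklore] -/
theorem moderateWindowCount_of_generalizedSzpiroBG (h : GeneralizedSzpiroConjectureBG) :
    ModerateWindowCount :=
  moderateWindowCount_of_cofiniteGenSzpiroAll (cofiniteGenSzpiroAll_of_generalizedSzpiroBG h)

/-- `ABC` (strict `<` / `0 < C` form of the summit) gives B–G's generalized Szpiro conjecture, by
Bombieri–Gubler Thm. 12.5.12 (a) ⟹ (c) (`abcLe_iff_generalizedSzpiroBG_holds`, PROVED in the tree;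
the strict form is weakened to the printed `≤` form first). [cite: BombieriGubler2006, Thm. 12.5.12] -/
theorem ModerateWindowCount.generalizedSzpiroBG_of_abc (habc : _root_.ABC) :
    GeneralizedSzpiroConjectureBG := by
  refine abcLe_iff_generalizedSzpiroBG_holds.mp fun ε hε ↦ ?_
  obtain ⟨C, -, hC⟩ := habc ε hε
  exact ⟨C, fun a b c h ↦ (hC a b c h).le⟩

/-- **CALIBRATION OF THE STUB (unconditional): cofinite generalized Szpiro for every exponent `> 6`
on the non-CM-`j` minimal models `↔ ABC`.** `→`: Frey bookkeeping + Mahler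
(`TwistAmplificationAssembly.abc_of_cofinite_genSzpiro`, whose conclusion is the displayed sentence of
`ABC`); `←`: B–G 12.5.12 (`ModerateWindowCount.generalizedSzpiroBG_of_abc`) and
`cofiniteGenSzpiroAll_of_generalizedSzpiroBG`. This is the registered stub `stub_cofiniteGenSzpiroAll`
of line `SketchIdeator3` of this crux: it is the summit, neither more nor less.
[cite: BombieriGubler2006, Thm. 12.5.12] -/
theorem cofiniteGenSzpiroAll_iff_abc :
    (∀ s : ℝ, 6 < s → ∃ N₀ : ℝ, ∀ W₀ : WeierstrassCurve ℤ, (W₀.baseChange ℚ).IsElliptic →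
      (∀ v : HeightOneSpectrum ℤ, (W₀.baseChange ℚ).IsMinimalAt v) → W₀.c₄ ≠ 0 → W₀.c₆ ≠ 0 →
        N₀ ≤ (((W₀.baseChange ℚ).conductorNorm ℤ : ℕ) : ℝ) →
          ((max |W₀.Δ| (|W₀.c₄| ^ 3) : ℤ) : ℝ) ≤ (((W₀.baseChange ℚ).conductorNorm ℤ : ℕ) : ℝ) ^ s) ↔
    _root_.ABC := by
  refine ⟨fun h ↦ ?_, fun habc ↦
    cofiniteGenSzpiroAll_of_generalizedSzpiroBG (ModerateWindowCount.generalizedSzpiroBG_of_abc habc)⟩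
  rw [_root_.ABC_iff]
  exact TwistAmplificationAssembly.abc_of_cofinite_genSzpiro h

/-- **The summit implies the crux**: `ABC → ModerateWindowCount`. Consequence: the crux (a node of a
route TOWARDS `ABC`) is not refutable by any unconditional theorem unless abc is false — the formal
content of the standing disprover's verdict RESISTS. [folklore] -/
theorem moderateWindowCount_of_abc (habc : _root_.ABC) : ModerateWindowCount :=
  moderateWindowCount_of_generalizedSzpiroBG (ModerateWindowCount.generalizedSzpiroBG_of_abc habc)

/-- **The crux ⟹ cofinite generalized Szpiro for every exponent `s > 6`**, modulo the route's open
support `QuadraticTwistInvariants` (stmt-ABC-1977): the window count at `σ := (6 + s)/2 ∈ (6, s)` is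
amplified to `s` along prime quadratic twists by the CLOSED support `twistAmplificationLemma_proof`
(stmt-ABC-1978) — packaged as `TwistAmplificationAssembly.cofinite_genSzpiro`. [folklore] -/
theorem cofiniteGenSzpiroAll_of_moderateWindowCount (hTw : QuadraticTwistInvariants)
    (h : ModerateWindowCount) :
    ∀ s : ℝ, 6 < s → ∃ N₀ : ℝ, ∀ W₀ : WeierstrassCurve ℤ, (W₀.baseChange ℚ).IsElliptic →
      (∀ v : HeightOneSpectrum ℤ, (W₀.baseChange ℚ).IsMinimalAt v) → W₀.c₄ ≠ 0 → W₀.c₆ ≠ 0 →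
        N₀ ≤ (((W₀.baseChange ℚ).conductorNorm ℤ : ℕ) : ℝ) →
          ((max |W₀.Δ| (|W₀.c₄| ^ 3) : ℤ) : ℝ) ≤ (((W₀.baseChange ℚ).conductorNorm ℤ : ℕ) : ℝ) ^ s :=
  fun _ hs ↦ TwistAmplificationAssembly.cofinite_genSzpiro twistAmplificationLemma_proof hTw h hs

/-- **The crux ⟹ the summit**, modulo `QuadraticTwistInvariants` (stmt-ABC-1977): cofinite
generalized Szpiro for all exponents `> 6` (`cofiniteGenSzpiroAll_of_moderateWindowCount`), then Frey
bookkeeping + Mahler's `S`-unit finiteness (`cofiniteGenSzpiroAll_iff_abc`) — the content of the route's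
`Assembly` (`twistAmplification_assembly_proof`) applied to the closed support
`twistAmplificationLemma_proof`. [folklore] -/
theorem abc_of_moderateWindowCount (hTw : QuadraticTwistInvariants) (h : ModerateWindowCount) :
    _root_.ABC :=
  cofiniteGenSzpiroAll_iff_abc.mp (cofiniteGenSzpiroAll_of_moderateWindowCount hTw h)

/-- The same through the route's `Assembly` verbatim (`twistAmplification_assembly_proof`), as a
regression check that the two packagings agree. -/
example (hTw : QuadraticTwistInvariants) (h : ModerateWindowCount) : _root_.ABC :=
  twistAmplification_assembly_proof twistAmplificationLemma_proof hTw h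

/-- **CALIBRATION OF THE CRUX (modulo stmt-ABC-1977): `ModerateWindowCount ↔ ABC`.** Given Tate's
algorithm for prime-to-`6N` quadratic twists (`QuadraticTwistInvariants`, provable now, open support),
the crux as typed IS the summit: `→` by amplification + Frey bookkeeping (`abc_of_moderateWindowCount`),
`←` by B–G 12.5.12 and the inert box (`moderateWindowCount_of_abc`). So no line of this crux can
have stubs weaker than abc; inside the route the node is derived from `SharpModerateLaw` (stmt-ABC-1975)
by the closed glue `sharpLawGivesWindow_proof` (stmt-ABC-14144). [folklore] -/
theorem moderateWindowCount_iff_abc (hTw : QuadraticTwistInvariants) : ModerateWindowCount ↔ _root_.ABC :=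
  ⟨abc_of_moderateWindowCount hTw, moderateWindowCount_of_abc⟩

/-- **Rung order: the crux implies the sibling crux `SomeWindowSaving`** (stmt-ABC-1976: SOME window,
SOME saving), by the instance `σ := 7`. [folklore] -/
theorem someWindowSaving_of_moderateWindowCount (h : ModerateWindowCount) : SomeWindowSaving := by
  obtain ⟨κ, δ, C, hκ, hκσ, hδ, hC⟩ := h 7 (by norm_num)
  exact ⟨κ, 7, δ, C, hκ, hκσ, hδ, hC⟩

/-- **The `κ := 6` lever** of the idea cards kappa-six-near-violators / exceptional-set-by-conductor
(glue only): NEAR-VIOLATOR SPARSITY — for every `σ > 6` the curves ON OR ABOVE the Szpiro line,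
`N ≤ X`, `N⁶ ≤ M⁺ ≤ N^σ`, number `≤ C · X^δ` for SOME `δ < (σ − 6)/(2σ − 6)` — implies the crux with the
witness `κ := 6`. Its hypothesis is abc-strength AND adds at-the-line statistics (the window `[6, σ]`
is populated forever by Masser-type curves), so it is STRONGER than the crux, not a weaker stub.
[folklore] -/
theorem moderateWindowCount_of_nearViolatorSparsity
    (h : ∀ σ : ℝ, 6 < σ → ∃ δ C : ℝ, δ < (σ - 6) / (2 * σ - 6) ∧
      ∀ X : ℝ, 1 ≤ X → (windowCount 6 σ X : ℝ) ≤ C * X ^ δ) :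
    ModerateWindowCount := by
  rw [moderateWindowCount_iff]
  intro σ hσ
  obtain ⟨δ, C, hδ, hC⟩ := h σ hσ
  exact ⟨6, δ, C, by norm_num, hσ, hδ, hC⟩

end Summit.ABC.ABC.Theorems

end
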